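import Summits.PneNP.PneNP.Theses.UniformStream

/-!
# `UniformStreamLB` (crux stmt-PneNP-16045, route `UniformStream`) — negative-side support, part 1/2:
# honest UNIFORM `TM2` machines for the crux's streaming class (refuter crux-attack seat)

`UniformStreamLB := ∃ s, IsTimeConstructible s ∧ ∀ c, ¬ ∃ A M₀ M₁ M₂, …` asks for a size function
`s` such that `MCSP[s]` has NO uniform one-pass streaming decider — ONE Mathlib `TM2` machine each
for init (input `encodeNat N`), update (input `boolPair st [b]`) and accept (input: the state),
quantified BEFORE `∀ N`, with space and honest step budget `s(⌊log₂ N⌋)^c + c` — for every `c`.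

This part builds the machines used by part 2 (`LargeSizeNoWitness.lean`), sorry-free:

* `dfaMachine q₀ δ out B` — a generic UNIFORM machine (one stack, one label, finite control
  `Q × Bool`): each `TM2` step pops 8 symbols into a finite automaton `δ`, and on end of input
  pushes `out q` (length `≤ B`), resets and halts; `dfaMachine_outputsWithin`: on input `w` it
  halts with output `out (w.foldl δ q₀)` within `|w| / 8 + 1` steps (honest: fixed `Stmt` depth,
  in contrast with the per-`N` one-step machines that sank the non-uniform twin stmt-PneNP-0265).
* two automata: `δpow` (3 states; accepts exactly the numerals `0^k 1 = encodeNat (2^k)`) and the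
  six-symbol absorber `δ6` on `Q6 = {l // l.length ≤ 6}` (keeps `w.take 6`).
-/

noncomputable section

set_option linter.dupNamespace false

open Turing Computability
open Literature.Computability.Complexity Literature.Computability.MetaComplexity

namespace Summit.PneNP.PneNP.Theorems.UniformStreamLB.Negative


section DFAEmit

variable {Q : Type} (q₀ : Q) (δ : Q → Bool → Q) (out : Q → List Bool) (B : ℕ)

/-- pop handler: a symbol advances the automaton, `none` (empty stack) raises the end flag. [folklore] -/
def popFn : Q × Bool → Option Bool → Q × Bool
  | v, none => (v.1, true)
  | v, some b => (δ v.1 b, false)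

/-- emit phase: push `(out q).take j` (so that the stack reads it top-down), reset, halt. [folklore] -/
def emitStmt : ℕ → TM2.Stmt (fun _ : Unit => Bool) Unit (Q × Bool)
  | 0 => TM2.Stmt.load (fun _ => (q₀, false)) TM2.Stmt.halt
  | j + 1 => TM2.Stmt.branch (fun v => decide (j < (out v.1).length))
      (TM2.Stmt.push () (fun v => (out v.1).getD j false) (emitStmt j)) (emitStmt j)

/-- pop phase: pop up to `j` symbols; on end-of-input emit, else continue with the next step. [folklore] -/
def popStmt : ℕ → TM2.Stmt (fun _ : Unit => Bool) Unit (Q × Bool)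
  | 0 => TM2.Stmt.goto fun _ => ()
  | j + 1 => TM2.Stmt.pop () (popFn δ)
      (TM2.Stmt.branch (fun v => v.2) (emitStmt q₀ out B) (popStmt j))

variable [Fintype Q]

/-- The one-stack, one-label machine: each step runs `popStmt 8`. [folklore] -/
@[reducible] def dfaTM : FinTM2 where
  K := Unit
  k₀ := ()
  k₁ := ()
  Γ := fun _ => Bool
  Λ := Unit
  main := ()
  σ := Q × Bool
  initialState := (q₀, false)
  m := fun _ => popStmt q₀ δ out B 8

/-- … as a `TM2ComputableAux Bool Bool`. [folklore] -/
@[reducible] def dfaMachine : TM2ComputableAux Bool Bool :=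
  ⟨dfaTM q₀ δ out B, Equiv.refl Bool, Equiv.refl Bool⟩

/-- The bare step function on configurations (definitionally the machine's). [folklore] -/
def stepFn : Option (TM2.Cfg (fun _ : Unit => Bool) Unit (Q × Bool)) →
    Option (TM2.Cfg (fun _ : Unit => Bool) Unit (Q × Bool)) :=
  flip bind (TM2.step fun _ : Unit => popStmt q₀ δ out B 8)

omit [Fintype Q] in
/-- One machine step from a live configuration runs `popStmt 8` (definitional). [folklore] -/
theorem stepFn_some (v : Q × Bool) (S : Unit → List Bool) :
    stepFn q₀ δ out B (some ⟨some (), v, S⟩) = some (TM2.stepAux (popStmt q₀ δ out B 8) v S) :=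
  rfl

omit [Fintype Q] in
/-- Semantics of the emit phase: push `(out q).take j`, reset, halt. [folklore] -/
theorem stepAux_emitStmt (j : ℕ) (q : Q) (S : List Bool) :
    TM2.stepAux (emitStmt q₀ out j) (q, true) (fun _ => S) =
      ⟨none, (q₀, false), fun _ => (out q).take j ++ S⟩ := by
  induction j generalizing S with
  | zero => rfl
  | succ j ih =>
    by_cases hj : j < (out q).length
    · simp only [emitStmt, TM2.stepAux, hj, decide_true, cond_true]
      rw [Function.update_eq_const_of_subsingleton]
      change TM2.stepAux (emitStmt q₀ out j) (q, true) (fun _ => (out q).getD j false :: S) = _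
      rw [ih, List.take_succ_eq_append_getElem hj, List.getD_eq_getElem _ _ hj, List.append_assoc,
        List.singleton_append]
    · simp only [emitStmt, TM2.stepAux, hj, decide_false, cond_false]
      push Not at hj
      rw [ih, List.take_of_length_le hj, List.take_of_length_le (by omega)]

omit [Fintype Q] in
/-- Semantics of the pop phase within one step: absorb `j` symbols if available, otherwise
absorb what is left and emit. [folklore] -/
theorem stepAux_popStmt (j : ℕ) (q : Q) (w : List Bool) :
    TM2.stepAux (popStmt q₀ δ out B j) (q, false) (fun _ => w) =
      if j ≤ w.length then ⟨some (), ((w.take j).foldl δ q, false), fun _ => w.drop j⟩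
      else TM2.stepAux (emitStmt q₀ out B) (w.foldl δ q, true) (fun _ => []) := by
  induction j generalizing q w with
  | zero => simp [popStmt, TM2.stepAux]
  | succ j ih =>
    cases w with
    | nil =>
      simp only [popStmt, TM2.stepAux, List.head?_nil, popFn, List.tail_nil, cond_true,
        List.length_nil, Nat.succ_ne_zero, Nat.le_zero, if_false, List.foldl_nil]
      rw [Function.update_eq_const_of_subsingleton]
      rfl
    | cons b w =>
      simp only [popStmt, TM2.stepAux, List.head?_cons, popFn, List.tail_cons, cond_false]
      rw [Function.update_eq_const_of_subsingleton]
      change TM2.stepAux (popStmt q₀ δ out B j) (δ q b, false) (fun _ => w) = _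
      rw [ih]
      simp only [List.length_cons, Nat.succ_le_succ_iff, List.take_succ_cons, List.foldl_cons,
        List.drop_succ_cons]

omit [Fintype Q] in
/-- After `i` full steps (`8 i ≤ |w|`) the machine has absorbed `w.take (8 i)`. [folklore] -/
theorem run_full (w : List Bool) (i : ℕ) (hi : 8 * i ≤ w.length) :
    (stepFn q₀ δ out B)^[i] (some ⟨some (), (q₀, false), fun _ => w⟩) =
      some ⟨some (), ((w.take (8 * i)).foldl δ q₀, false), fun _ => w.drop (8 * i)⟩ := by
  induction i with
  | zero => rfl
  | succ i ih =>
    rw [Function.iterate_succ_apply', ih (by omega), stepFn_some,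
      stepAux_popStmt, if_pos (by rw [List.length_drop]; omega)]
    congr 2
    · rw [show 8 * (i + 1) = 8 * i + 8 by ring, List.take_add, List.foldl_append]
    · funext k
      rw [List.drop_drop, show 8 * i + 8 = 8 * (i + 1) by ring]

omit [Fintype Q] in
/-- The complete run: `|w| / 8 + 1` steps to the halting configuration. [folklore] -/
theorem run_halt (hB : ∀ q, (out q).length ≤ B) (w : List Bool) :
    (stepFn q₀ δ out B)^[w.length / 8 + 1] (some ⟨some (), (q₀, false), fun _ => w⟩) =
      some ⟨none, (q₀, false), fun _ => out (w.foldl δ q₀)⟩ := by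
  rw [Function.iterate_succ_apply',
    run_full q₀ δ out B w (w.length / 8) (Nat.mul_div_le w.length 8), stepFn_some,
    stepAux_popStmt, if_neg (by rw [List.length_drop]; omega), stepAux_emitStmt,
    ← List.foldl_append, List.take_append_drop, List.take_of_length_le (hB _), List.append_nil]

/-- **Honest uniform step count**: on input `w` the machine halts with output
`out (w.foldl δ q₀)` after exactly `|w| / 8 + 1` steps. [folklore] -/
theorem dfaMachine_outputsWithin (hB : ∀ q, (out q).length ≤ B) (w : List Bool) :
    (dfaMachine q₀ δ out B).OutputsWithin w (out (w.foldl δ q₀)) (w.length / 8 + 1) := by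
  refine ⟨⟨⟨w.length / 8 + 1, ?_⟩, le_rfl⟩⟩
  simp only [Equiv.refl_symm, Equiv.coe_refl, List.map_id, Option.map_some]
  exact run_halt q₀ δ out B hB w

end DFAEmit

/-! ### Three automata -/

section Automata

/-- three-state control: "only `0`s so far" / "exactly `0…01`" or "exactly `1`" / dead. [folklore] -/
inductive Q3 | zeros | hit | dead
  deriving DecidableEq, Fintype

/-- automaton for `0^k 1` (the numerals `encodeNat (2^k)`): [folklore] -/
def δpow : Q3 → Bool → Q3
  | .zeros, false => .zeros
  | .zeros, true => .hit
  | _, _ => .dead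

/-- The dead state is absorbing. [folklore] -/
theorem foldl_δpow_dead (w : List Bool) : w.foldl δpow .dead = .dead := by
  induction w with
  | nil => rfl
  | cons b w ih => cases b <;> exact ih

/-- From `hit`, only the empty word stays in `hit`. [folklore] -/
theorem foldl_δpow_hit (w : List Bool) : w.foldl δpow .hit = .hit ↔ w = [] := by
  cases w with
  | nil => simp
  | cons b w => cases b <;> simp [δpow, foldl_δpow_dead]

/-- The automaton accepts exactly the words `0^k 1`. [folklore] -/
theorem foldl_δpow_zeros (w : List Bool) :
    w.foldl δpow .zeros = .hit ↔ ∃ k, w = List.replicate k false ++ [true] := by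
  induction w with
  | nil => simp
  | cons b w ih =>
    cases b with
    | false =>
      rw [List.foldl_cons, show δpow .zeros false = .zeros from rfl, ih]
      constructor
      · rintro ⟨k, rfl⟩
        exact ⟨k + 1, by simp [List.replicate_succ]⟩
      · rintro ⟨k, hk⟩
        cases k with
        | zero => simp at hk
        | succ k =>
          refine ⟨k, ?_⟩
          simpa [List.replicate_succ] using hk
    | true =>
      rw [List.foldl_cons, show δpow .zeros true = .hit from rfl, foldl_δpow_hit]
      constructor
      · rintro rfl
        exact ⟨0, rfl⟩
      · rintro ⟨k, hk⟩
        cases k with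
        | zero => simpa using hk
        | succ k => simp [List.replicate_succ] at hk

/-- bounded-prefix absorber: the first six symbols. [folklore] -/
abbrev Q6 := {l : List Bool // l.length ≤ 6}

/-- `Q6` is finite (words of length `≤ 6`). [folklore] -/
noncomputable instance : Fintype Q6 :=
  haveI : Finite Q6 := (List.finite_length_le Bool 6).to_subtype
  Fintype.ofFinite _

/-- initial absorber state [folklore] -/
def q6 : Q6 := ⟨[], by simp⟩

/-- absorb while there is room [folklore] -/
def δ6 (v : Q6) (b : Bool) : Q6 :=
  if h : v.1.length < 6 then ⟨v.1 ++ [b], by simpa using h⟩ else v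

/-- The absorber keeps the first six symbols. [folklore] -/
theorem foldl_δ6 (w : List Bool) (v : Q6) :
    (w.foldl δ6 v).1 = v.1 ++ w.take (6 - v.1.length) := by
  induction w generalizing v with
  | nil => simp
  | cons b w ih =>
    rw [List.foldl_cons, ih]
    by_cases h : v.1.length < 6
    · rw [δ6, dif_pos h]
      simp only [List.length_append, List.length_singleton, List.append_assoc,
        List.singleton_append]
      rw [show 6 - v.1.length = (6 - (v.1.length + 1)) + 1 by omega, List.take_succ_cons]
    · rw [δ6, dif_neg h, show 6 - v.1.length = 0 by omega]
      simp

/-- From the empty absorber state the run keeps `w.take 6`. [folklore] -/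
theorem foldl_δ6_q6 (w : List Bool) : (w.foldl δ6 q6).1 = w.take 6 := by
  rw [foldl_δ6]; rfl

end Automata


end Summit.PneNP.PneNP.Theorems.UniformStreamLB.Negative

end
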